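import Summits.AnomalousDissipation.AnomalousDissipation.Theorems.SolenoidalFractalHomogenisationLagrangianStepLedgerSplit
import HarnessLib

/-!
# K1L_D (stmt-AnomalousDissipation-27980), S23‴ `stub_windowDefectH`: the label-split window ledger WITH ADDITIVE SLOP —
# part 1: one window and the three sums (helper; `--supports … --as helper`; lead-k1l-onelevel-p1 g3)

`window_ledger_split` (p661019) asks the low-label window error `e k` to be dissipation-dominated EXACTLY,
`|⟪y, e k⟫| ≤ η √𝔇_k √𝔇*_k(y)`, and the high-label budget to hold EXACTLY, `Σ (F k + 2 c k) ≤ η′ Σ 𝔇_k`.  Under the frame distortion no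
label class of `L²(𝕋³)` is exactly invariant (hops of amplitude `C₂δ` per `≲ C₂ N_m` labels, tails `exp(−dist/(C₂N_m))`: p4 g12 L4c §3.1,
§4.1), and the dissipation weight the cell side delivers is that of the LOW-LABEL PART `z k` of the state, which differs from `𝔇_k(u k)` by a
super-small additive term (the coarse flow kills the high-label part up to a tail).  So every operator-level input of the S23‴ assembly
arrives with a super-small ADDITIVE slop.  This file re-runs the ledger with
* (DD) with slop: `|⟪y, e k⟫| ≤ η √𝔇_k √𝔇*_k(y) + a k · ‖y‖` (`a k ≥ 0`),
* budget with slop: `Σ_{k<K} (F k + 2 c k) ≤ η′ Σ_{k<K} 𝔇_k + B` (`B ≥ 0`),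
everything else as in `window_ledger_split`.  This file: the one-window balances and the energy / discrepancy / duality sums with slop;
the ledger itself (`window_ledger_split_slop`) is in `…LedgerSplitSlop`.  Pure Hilbert-space algebra.  Infrastructure for rung F-D1.A0;
NOT a proof of the crux or of anomalous dissipation.
-/

set_option linter.dupNamespace false

namespace Summit.AnomalousDissipation.AnomalousDissipation.Theorems.SolenoidalFractalHomogenisation.LagrangianStep

open scoped InnerProductSpace
open ContinuousLinearMap

noncomputable section

variable {V : Type*} [NormedAddCommGroup V] [InnerProductSpace ℝ V] [CompleteSpace V]

/-! ## One window under (DD) with slop -/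

/-- Under (DD) with slop the error is small in norm: `‖e‖ ≤ η √𝔇 + a`. -/
theorem norm_err_le_slop {T : V →L[ℝ] V} {u e : V} {η a : ℝ} (hη : 0 ≤ η) (ha : 0 ≤ a)
    (hDD : ∀ y : V, |⟪y, e⟫_ℝ| ≤ η * Real.sqrt (‖u‖ ^ 2 - ‖T u‖ ^ 2) * Real.sqrt (‖y‖ ^ 2 - ‖adjoint T y‖ ^ 2) + a * ‖y‖) :
    ‖e‖ ≤ η * Real.sqrt (‖u‖ ^ 2 - ‖T u‖ ^ 2) + a := by
  have h := hDD e
  have h1 : |⟪e, e⟫_ℝ| = ‖e‖ ^ 2 := by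
    rw [real_inner_self_eq_norm_sq, abs_of_nonneg (by positivity)]
  have h2 : Real.sqrt (‖e‖ ^ 2 - ‖adjoint T e‖ ^ 2) ≤ ‖e‖ := by
    calc Real.sqrt (‖e‖ ^ 2 - ‖adjoint T e‖ ^ 2) ≤ Real.sqrt (‖e‖ ^ 2) :=
          Real.sqrt_le_sqrt (by nlinarith [norm_nonneg (adjoint T e)])
      _ = ‖e‖ := Real.sqrt_sq (norm_nonneg _)
  have hA : 0 ≤ η * Real.sqrt (‖u‖ ^ 2 - ‖T u‖ ^ 2) := mul_nonneg hη (Real.sqrt_nonneg _)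
  have h3 : ‖e‖ ^ 2 ≤ (η * Real.sqrt (‖u‖ ^ 2 - ‖T u‖ ^ 2) + a) * ‖e‖ := by
    calc ‖e‖ ^ 2 = |⟪e, e⟫_ℝ| := h1.symm
      _ ≤ η * Real.sqrt (‖u‖ ^ 2 - ‖T u‖ ^ 2) * Real.sqrt (‖e‖ ^ 2 - ‖adjoint T e‖ ^ 2) + a * ‖e‖ := h
      _ ≤ η * Real.sqrt (‖u‖ ^ 2 - ‖T u‖ ^ 2) * ‖e‖ + a * ‖e‖ := by
          have := mul_le_mul_of_nonneg_left h2 hA; linarith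
      _ = (η * Real.sqrt (‖u‖ ^ 2 - ‖T u‖ ^ 2) + a) * ‖e‖ := by ring
  by_cases h0 : ‖e‖ = 0
  · rw [h0]; positivity
  · have hpos : 0 < ‖e‖ := lt_of_le_of_ne (norm_nonneg _) (Ne.symm h0)
    nlinarith

/-- Under (DD) with slop: `⟪T u, e⟫ ≤ η 𝔇 + a ‖u‖`. -/
theorem inner_apply_err_le_slop {T : V →L[ℝ] V} (hT : ∀ x, ‖T x‖ ≤ ‖x‖) {u e : V} {η a : ℝ} (hη : 0 ≤ η) (ha : 0 ≤ a)
    (hDD : ∀ y : V, |⟪y, e⟫_ℝ| ≤ η * Real.sqrt (‖u‖ ^ 2 - ‖T u‖ ^ 2) * Real.sqrt (‖y‖ ^ 2 - ‖adjoint T y‖ ^ 2) + a * ‖y‖) :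
    ⟪T u, e⟫_ℝ ≤ η * (‖u‖ ^ 2 - ‖T u‖ ^ 2) + a * ‖u‖ := by
  have h := hDD (T u)
  have hD : 0 ≤ ‖u‖ ^ 2 - ‖T u‖ ^ 2 := dissip_nonneg hT u
  have h2 : Real.sqrt (‖T u‖ ^ 2 - ‖adjoint T (T u)‖ ^ 2) ≤ Real.sqrt (‖u‖ ^ 2 - ‖T u‖ ^ 2) :=
    Real.sqrt_le_sqrt (dissipAdj_apply_le_dissip T u)
  have hA : 0 ≤ η * Real.sqrt (‖u‖ ^ 2 - ‖T u‖ ^ 2) := mul_nonneg hη (Real.sqrt_nonneg _)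
  have h3 : a * ‖T u‖ ≤ a * ‖u‖ := mul_le_mul_of_nonneg_left (hT u) ha
  calc ⟪T u, e⟫_ℝ ≤ |⟪T u, e⟫_ℝ| := le_abs_self _
    _ ≤ η * Real.sqrt (‖u‖ ^ 2 - ‖T u‖ ^ 2) * Real.sqrt (‖T u‖ ^ 2 - ‖adjoint T (T u)‖ ^ 2) + a * ‖T u‖ := h
    _ ≤ η * Real.sqrt (‖u‖ ^ 2 - ‖T u‖ ^ 2) * Real.sqrt (‖u‖ ^ 2 - ‖T u‖ ^ 2) + a * ‖u‖ := by
        have := mul_le_mul_of_nonneg_left h2 hA; linarith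
    _ = η * (‖u‖ ^ 2 - ‖T u‖ ^ 2) + a * ‖u‖ := by
      rw [mul_assoc, Real.mul_self_sqrt hD]

/-- `‖e‖² ≤ 2η²𝔇 + 2a²` under (DD) with slop. -/
theorem norm_err_sq_le_slop {T : V →L[ℝ] V} (hT : ∀ x, ‖T x‖ ≤ ‖x‖) {u e : V} {η a : ℝ} (hη : 0 ≤ η) (ha : 0 ≤ a)
    (hDD : ∀ y : V, |⟪y, e⟫_ℝ| ≤ η * Real.sqrt (‖u‖ ^ 2 - ‖T u‖ ^ 2) * Real.sqrt (‖y‖ ^ 2 - ‖adjoint T y‖ ^ 2) + a * ‖y‖) :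
    ‖e‖ ^ 2 ≤ 2 * η ^ 2 * (‖u‖ ^ 2 - ‖T u‖ ^ 2) + 2 * a ^ 2 := by
  have hD : 0 ≤ ‖u‖ ^ 2 - ‖T u‖ ^ 2 := dissip_nonneg hT u
  have h3 := norm_err_le_slop hη ha hDD
  have hA : 0 ≤ η * Real.sqrt (‖u‖ ^ 2 - ‖T u‖ ^ 2) := mul_nonneg hη (Real.sqrt_nonneg _)
  have h4 : ‖e‖ ^ 2 ≤ (η * Real.sqrt (‖u‖ ^ 2 - ‖T u‖ ^ 2) + a) ^ 2 := pow_le_pow_left₀ (norm_nonneg _) h3 2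
  have h5 : (η * Real.sqrt (‖u‖ ^ 2 - ‖T u‖ ^ 2) + a) ^ 2 ≤ 2 * (η * Real.sqrt (‖u‖ ^ 2 - ‖T u‖ ^ 2)) ^ 2 + 2 * a ^ 2 := by
    nlinarith [sq_nonneg (η * Real.sqrt (‖u‖ ^ 2 - ‖T u‖ ^ 2) - a)]
  have h6 : (η * Real.sqrt (‖u‖ ^ 2 - ‖T u‖ ^ 2)) ^ 2 = η ^ 2 * (‖u‖ ^ 2 - ‖T u‖ ^ 2) := by
    rw [mul_pow, Real.sq_sqrt hD]
  linarith

/-- ONE-WINDOW ENERGY BALANCE with slop and the extra error: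
`(1 − 2η − 2η²)·𝔇 ≤ ‖u‖² − ‖T u + e + f‖² + 2a‖u‖ + 2a² + 2‖u‖·‖T† f‖ + 2|⟪e,f⟫| + ‖f‖²`. -/
theorem dissip_le_energy_drop_slop {T : V →L[ℝ] V} (hT : ∀ x, ‖T x‖ ≤ ‖x‖) {u e : V} (f : V) {η a : ℝ} (hη : 0 ≤ η) (ha : 0 ≤ a)
    (hDD : ∀ y : V, |⟪y, e⟫_ℝ| ≤ η * Real.sqrt (‖u‖ ^ 2 - ‖T u‖ ^ 2) * Real.sqrt (‖y‖ ^ 2 - ‖adjoint T y‖ ^ 2) + a * ‖y‖) :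
    (1 - 2 * η - 2 * η ^ 2) * (‖u‖ ^ 2 - ‖T u‖ ^ 2) ≤
      ‖u‖ ^ 2 - ‖T u + e + f‖ ^ 2 + 2 * (a * ‖u‖) + 2 * a ^ 2 + 2 * (‖u‖ * ‖adjoint T f‖) + 2 * |⟪e, f⟫_ℝ| + ‖f‖ ^ 2 := by
  have hD : 0 ≤ ‖u‖ ^ 2 - ‖T u‖ ^ 2 := dissip_nonneg hT u
  have h1 : ‖T u + e + f‖ ^ 2 = ‖T u + e‖ ^ 2 + 2 * ⟪T u + e, f⟫_ℝ + ‖f‖ ^ 2 := norm_add_sq_real _ _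
  have h1' : ‖T u + e‖ ^ 2 = ‖T u‖ ^ 2 + 2 * ⟪T u, e⟫_ℝ + ‖e‖ ^ 2 := norm_add_sq_real _ _
  have h2 : ⟪T u + e, f⟫_ℝ = ⟪T u, f⟫_ℝ + ⟪e, f⟫_ℝ := inner_add_left _ _ _
  have h3 : ⟪T u, f⟫_ℝ ≤ ‖u‖ * ‖adjoint T f‖ := (le_abs_self _).trans (abs_inner_apply_le_norm_mul_adjoint T u f)
  have h4 : ⟪e, f⟫_ℝ ≤ |⟪e, f⟫_ℝ| := le_abs_self _
  have h5 := inner_apply_err_le_slop hT hη ha hDD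
  have h6 := norm_err_sq_le_slop hT hη ha hDD
  nlinarith

/-- ONE-WINDOW DISCREPANCY BALANCE with slop and the extra error:
`‖T d + e + f‖² ≤ ‖d‖² + 3η²·𝔇 + 2a‖d‖ + 2a² + 2‖d‖·‖T† f‖ + 2|⟪e,f⟫| + ‖f‖²`. -/
theorem norm_sq_apply_add_err_le_slop {T : V →L[ℝ] V} (hT : ∀ x, ‖T x‖ ≤ ‖x‖) {u e : V} (d f : V) {η a : ℝ} (hη : 0 ≤ η)
    (ha : 0 ≤ a)
    (hDD : ∀ y : V, |⟪y, e⟫_ℝ| ≤ η * Real.sqrt (‖u‖ ^ 2 - ‖T u‖ ^ 2) * Real.sqrt (‖y‖ ^ 2 - ‖adjoint T y‖ ^ 2) + a * ‖y‖) :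
    ‖T d + e + f‖ ^ 2 ≤ ‖d‖ ^ 2 + 3 * η ^ 2 * (‖u‖ ^ 2 - ‖T u‖ ^ 2) + 2 * (a * ‖d‖) + 2 * a ^ 2
      + 2 * (‖d‖ * ‖adjoint T f‖) + 2 * |⟪e, f⟫_ℝ| + ‖f‖ ^ 2 := by
  have hD : 0 ≤ ‖u‖ ^ 2 - ‖T u‖ ^ 2 := dissip_nonneg hT u
  have hDd : 0 ≤ ‖d‖ ^ 2 - ‖T d‖ ^ 2 := dissip_nonneg hT d
  have h1 : ‖T d + e + f‖ ^ 2 = ‖T d + e‖ ^ 2 + 2 * ⟪T d + e, f⟫_ℝ + ‖f‖ ^ 2 := norm_add_sq_real _ _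
  have h1' : ‖T d + e‖ ^ 2 = ‖T d‖ ^ 2 + 2 * ⟪T d, e⟫_ℝ + ‖e‖ ^ 2 := norm_add_sq_real _ _
  have h2 : ⟪T d + e, f⟫_ℝ = ⟪T d, f⟫_ℝ + ⟪e, f⟫_ℝ := inner_add_left _ _ _
  have h3 : ⟪T d, f⟫_ℝ ≤ ‖d‖ * ‖adjoint T f‖ := (le_abs_self _).trans (abs_inner_apply_le_norm_mul_adjoint T d f)
  have h4 : ⟪e, f⟫_ℝ ≤ |⟪e, f⟫_ℝ| := le_abs_self _
  have h6 := norm_err_sq_le_slop hT hη ha hDD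
  -- the cross term: `⟪T d, e⟫ ≤ η √𝔇(u) √𝔇(d) + a‖d‖` and AM–GM
  have h5 : ⟪T d, e⟫_ℝ ≤ η * Real.sqrt (‖u‖ ^ 2 - ‖T u‖ ^ 2) * Real.sqrt (‖d‖ ^ 2 - ‖T d‖ ^ 2) + a * ‖d‖ := by
    have h := hDD (T d)
    have h2 : Real.sqrt (‖T d‖ ^ 2 - ‖adjoint T (T d)‖ ^ 2) ≤ Real.sqrt (‖d‖ ^ 2 - ‖T d‖ ^ 2) :=
      Real.sqrt_le_sqrt (dissipAdj_apply_le_dissip T d)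
    have hA : 0 ≤ η * Real.sqrt (‖u‖ ^ 2 - ‖T u‖ ^ 2) := mul_nonneg hη (Real.sqrt_nonneg _)
    have h7 : a * ‖T d‖ ≤ a * ‖d‖ := mul_le_mul_of_nonneg_left (hT d) ha
    calc ⟪T d, e⟫_ℝ ≤ |⟪T d, e⟫_ℝ| := le_abs_self _
      _ ≤ _ := h
      _ ≤ _ := by have := mul_le_mul_of_nonneg_left h2 hA; linarith
  have h8 : 2 * (η * Real.sqrt (‖u‖ ^ 2 - ‖T u‖ ^ 2) * Real.sqrt (‖d‖ ^ 2 - ‖T d‖ ^ 2)) ≤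
      η ^ 2 * (‖u‖ ^ 2 - ‖T u‖ ^ 2) + (‖d‖ ^ 2 - ‖T d‖ ^ 2) := by
    have := two_mul_le_add_sq (η * Real.sqrt (‖u‖ ^ 2 - ‖T u‖ ^ 2)) (Real.sqrt (‖d‖ ^ 2 - ‖T d‖ ^ 2))
    rw [mul_pow, Real.sq_sqrt hD, Real.sq_sqrt hDd] at this
    linarith
  nlinarith

/-! ## The sums -/

/-- **ENERGY SUM with slop and the extra error** (true chain norm-bounded by its start):
`(1 − 2η − 2η²)·Σ𝔇 ≤ ‖u 0‖² − ‖u K‖² + Σ_{k<K} (2 a k ‖u 0‖ + 2 (a k)² + 2‖u 0‖·‖(T k)† (f k)‖ + 2|⟪e k, f k⟫| + ‖f k‖²)`. -/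
theorem dissip_sum_le_slop (T : ℕ → V →L[ℝ] V) (hT : ∀ k x, ‖T k x‖ ≤ ‖x‖) (u e f : ℕ → V) (η : ℝ) (a : ℕ → ℝ) (hη : 0 ≤ η)
    (ha : ∀ k, 0 ≤ a k)
    (hu : ∀ k, u (k + 1) = T k (u k) + e k + f k) (huB : ∀ k, ‖u k‖ ≤ ‖u 0‖)
    (hDD : ∀ k, ∀ y : V, |⟪y, e k⟫_ℝ| ≤
      η * Real.sqrt (‖u k‖ ^ 2 - ‖T k (u k)‖ ^ 2) * Real.sqrt (‖y‖ ^ 2 - ‖adjoint (T k) y‖ ^ 2) + a k * ‖y‖)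
    (K : ℕ) :
    (1 - 2 * η - 2 * η ^ 2) * ∑ k ∈ Finset.range K, (‖u k‖ ^ 2 - ‖T k (u k)‖ ^ 2) ≤
      ‖u 0‖ ^ 2 - ‖u K‖ ^ 2 +
        ∑ k ∈ Finset.range K, (2 * (a k * ‖u 0‖) + 2 * a k ^ 2 + 2 * (‖u 0‖ * ‖adjoint (T k) (f k)‖)
          + 2 * |⟪e k, f k⟫_ℝ| + ‖f k‖ ^ 2) := by
  induction K with
  | zero => simp
  | succ K ih =>
    rw [Finset.sum_range_succ, Finset.sum_range_succ, mul_add]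
    have hstep := dissip_le_energy_drop_slop (hT K) (f K) hη (ha K) (hDD K)
    rw [← hu K] at hstep
    have hmono : ‖u K‖ * ‖adjoint (T K) (f K)‖ ≤ ‖u 0‖ * ‖adjoint (T K) (f K)‖ :=
      mul_le_mul_of_nonneg_right (huB K) (norm_nonneg _)
    have hmono' : a K * ‖u K‖ ≤ a K * ‖u 0‖ := mul_le_mul_of_nonneg_left (huB K) (ha K)
    linarith

/-- **DISCREPANCY SUM with slop and the extra error**:
`‖u K − v K‖² ≤ 3η²·Σ𝔇 + Σ_{k<K} (4 a k ‖u 0‖ + 2 (a k)² + 4‖u 0‖·‖(T k)† (f k)‖ + 2|⟪e k, f k⟫| + ‖f k‖²)`. -/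
theorem norm_sq_sub_le_slop (T : ℕ → V →L[ℝ] V) (hT : ∀ k x, ‖T k x‖ ≤ ‖x‖) (u v e f : ℕ → V) (η : ℝ) (a : ℕ → ℝ)
    (hη : 0 ≤ η) (ha : ∀ k, 0 ≤ a k)
    (h0 : u 0 = v 0) (hv : ∀ k, v (k + 1) = T k (v k)) (hu : ∀ k, u (k + 1) = T k (u k) + e k + f k)
    (huB : ∀ k, ‖u k‖ ≤ ‖u 0‖)
    (hDD : ∀ k, ∀ y : V, |⟪y, e k⟫_ℝ| ≤
      η * Real.sqrt (‖u k‖ ^ 2 - ‖T k (u k)‖ ^ 2) * Real.sqrt (‖y‖ ^ 2 - ‖adjoint (T k) y‖ ^ 2) + a k * ‖y‖)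
    (K : ℕ) :
    ‖u K - v K‖ ^ 2 ≤ 3 * η ^ 2 * ∑ k ∈ Finset.range K, (‖u k‖ ^ 2 - ‖T k (u k)‖ ^ 2) +
      ∑ k ∈ Finset.range K, (4 * (a k * ‖u 0‖) + 2 * a k ^ 2 + 4 * (‖u 0‖ * ‖adjoint (T k) (f k)‖)
        + 2 * |⟪e k, f k⟫_ℝ| + ‖f k‖ ^ 2) := by
  induction K with
  | zero => simp [h0]
  | succ K ih =>
    rw [Finset.sum_range_succ, Finset.sum_range_succ, mul_add]
    have hrec : u (K + 1) - v (K + 1) = T K (u K - v K) + e K + f K := by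
      rw [hu K, hv K, map_sub]; abel
    rw [hrec]
    have hstep := norm_sq_apply_add_err_le_slop (hT K) (u K - v K) (f K) hη (ha K) (hDD K)
    have hvK : ‖v K‖ ≤ ‖v 0‖ := norm_exact_le T hT v hv K
    have hdK : ‖u K - v K‖ ≤ 2 * ‖u 0‖ := by
      calc ‖u K - v K‖ ≤ ‖u K‖ + ‖v K‖ := norm_sub_le _ _
        _ ≤ ‖u 0‖ + ‖v 0‖ := add_le_add (huB K) hvK
        _ = 2 * ‖u 0‖ := by rw [h0]; ring
    have hmono : ‖u K - v K‖ * ‖adjoint (T K) (f K)‖ ≤ 2 * ‖u 0‖ * ‖adjoint (T K) (f K)‖ :=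
      mul_le_mul_of_nonneg_right hdK (norm_nonneg _)
    have hmono' : a K * ‖u K - v K‖ ≤ a K * (2 * ‖u 0‖) := mul_le_mul_of_nonneg_left hdK (ha K)
    nlinarith [norm_nonneg (adjoint (T K) (f K)), norm_nonneg (u 0), ha K]

/-- **DUALITY SUM with slop and the extra error (inductive form).**  As `duality_sum_split`, plus the slop pairings `‖z‖·Σ_{k<K} a k`:
`|⟪z, u K − v K⟫| ≤ η √Σ𝔇 √(‖z‖² − ‖b‖²) + ‖z‖·Σ_{k+1<K} ‖T (k+1) (f k)‖ + [K ≠ 0]·|⟪z, f (K−1)⟫| + ‖z‖·Σ_{k<K} a k`. -/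
theorem duality_sum_slop (T : ℕ → V →L[ℝ] V) (hT : ∀ k x, ‖T k x‖ ≤ ‖x‖) (u v e f : ℕ → V) (η : ℝ) (a : ℕ → ℝ) (hη : 0 ≤ η)
    (ha : ∀ k, 0 ≤ a k)
    (h0 : u 0 = v 0) (hv : ∀ k, v (k + 1) = T k (v k)) (hu : ∀ k, u (k + 1) = T k (u k) + e k + f k)
    (hDD : ∀ k, ∀ y : V, |⟪y, e k⟫_ℝ| ≤
      η * Real.sqrt (‖u k‖ ^ 2 - ‖T k (u k)‖ ^ 2) * Real.sqrt (‖y‖ ^ 2 - ‖adjoint (T k) y‖ ^ 2) + a k * ‖y‖)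
    (K : ℕ) (z : V) :
    ∃ b : V, ‖b‖ ≤ ‖z‖ ∧ ⟪b, v 0⟫_ℝ = ⟪z, v K⟫_ℝ ∧
      |⟪z, u K - v K⟫_ℝ| ≤ η * Real.sqrt (∑ k ∈ Finset.range K, (‖u k‖ ^ 2 - ‖T k (u k)‖ ^ 2)) *
        Real.sqrt (‖z‖ ^ 2 - ‖b‖ ^ 2) + ‖z‖ * ∑ k ∈ Finset.range (K - 1), ‖T (k + 1) (f k)‖ +
        (if K = 0 then 0 else |⟪z, f (K - 1)⟫_ℝ|) + ‖z‖ * ∑ k ∈ Finset.range K, a k := by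
  induction K generalizing z with
  | zero =>
    refine ⟨z, le_rfl, rfl, ?_⟩
    simp [h0]
  | succ K ih =>
    obtain ⟨b, hb, hdual, hbound⟩ := ih (adjoint (T K) z)
    have hTz : ‖adjoint (T K) z‖ ≤ ‖z‖ := norm_adjoint_apply_le_of_contraction (hT K) z
    refine ⟨b, hb.trans hTz, ?_, ?_⟩
    · rw [hdual, adjoint_inner_left, ← hv K]
    · have hsplit : ⟪z, u (K + 1) - v (K + 1)⟫_ℝ =
          ⟪adjoint (T K) z, u K - v K⟫_ℝ + ⟪z, e K⟫_ℝ + ⟪z, f K⟫_ℝ := by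
        rw [hu K, hv K, adjoint_inner_left, map_sub]
        rw [show T K (u K) + e K + f K - T K (v K) = (T K (u K) - T K (v K)) + e K + f K by abel,
          inner_add_right, inner_add_right]
      set S : ℝ := ∑ k ∈ Finset.range K, (‖u k‖ ^ 2 - ‖T k (u k)‖ ^ 2) with hS_def
      set D : ℝ := ‖u K‖ ^ 2 - ‖T K (u K)‖ ^ 2 with hD_def
      set a' : ℝ := ‖adjoint (T K) z‖ ^ 2 - ‖b‖ ^ 2 with ha_def
      set c : ℝ := ‖z‖ ^ 2 - ‖adjoint (T K) z‖ ^ 2 with hc_def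
      have hS : 0 ≤ S := Finset.sum_nonneg fun k _ => dissip_nonneg (hT k) (u k)
      have hD : 0 ≤ D := dissip_nonneg (hT K) (u K)
      have ha' : 0 ≤ a' := by rw [ha_def]; nlinarith [norm_nonneg b, norm_nonneg (adjoint (T K) z)]
      have hc : 0 ≤ c := dissipAdj_nonneg (hT K) z
      have hsum : ∑ k ∈ Finset.range (K + 1), (‖u k‖ ^ 2 - ‖T k (u k)‖ ^ 2) = S + D := by
        rw [Finset.sum_range_succ]
      have hac : ‖z‖ ^ 2 - ‖b‖ ^ 2 = a' + c := by rw [ha_def, hc_def]; ring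
      have hasum : ∑ k ∈ Finset.range (K + 1), a k = (∑ k ∈ Finset.range K, a k) + a K := Finset.sum_range_succ _ _
      have hAs : 0 ≤ ∑ k ∈ Finset.range K, a k := Finset.sum_nonneg fun k _ => ha k
      -- the (DD) part
      have hmain : |⟪adjoint (T K) z, u K - v K⟫_ℝ| - (‖adjoint (T K) z‖ * ∑ k ∈ Finset.range (K - 1), ‖T (k + 1) (f k)‖ +
            (if K = 0 then 0 else |⟪adjoint (T K) z, f (K - 1)⟫_ℝ|) + ‖adjoint (T K) z‖ * ∑ k ∈ Finset.range K, a k)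
            + (|⟪z, e K⟫_ℝ| - a K * ‖z‖)
          ≤ η * Real.sqrt (S + D) * Real.sqrt (a' + c) := by
        calc _ ≤ η * Real.sqrt S * Real.sqrt a' + η * Real.sqrt D * Real.sqrt c := by
              have := hDD K z; linarith
          _ = η * (Real.sqrt S * Real.sqrt a' + Real.sqrt D * Real.sqrt c) := by ring
          _ ≤ η * (Real.sqrt (S + D) * Real.sqrt (a' + c)) :=
            mul_le_mul_of_nonneg_left (sqrt_mul_sqrt_add_le_sqrt_add_mul hS ha' hD hc) hη
          _ = η * Real.sqrt (S + D) * Real.sqrt (a' + c) := by ring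
      -- the inherited f-terms, re-expressed at the new top `z`
      have hconv : ‖adjoint (T K) z‖ * ∑ k ∈ Finset.range (K - 1), ‖T (k + 1) (f k)‖ +
            (if K = 0 then 0 else |⟪adjoint (T K) z, f (K - 1)⟫_ℝ|)
          ≤ ‖z‖ * ∑ k ∈ Finset.range (K + 1 - 1), ‖T (k + 1) (f k)‖ := by
        have hs0 : ∀ k, 0 ≤ ‖T (k + 1) (f k)‖ := fun k => norm_nonneg _
        rcases Nat.eq_zero_or_pos K with hK0 | hKpos
        · subst hK0; simp
        · rw [if_neg (by omega), show K + 1 - 1 = (K - 1) + 1 by omega, Finset.sum_range_succ, mul_add]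
          have h1 : ‖adjoint (T K) z‖ * ∑ k ∈ Finset.range (K - 1), ‖T (k + 1) (f k)‖
              ≤ ‖z‖ * ∑ k ∈ Finset.range (K - 1), ‖T (k + 1) (f k)‖ :=
            mul_le_mul_of_nonneg_right hTz (Finset.sum_nonneg fun k _ => hs0 k)
          have h2 : |⟪adjoint (T K) z, f (K - 1)⟫_ℝ| ≤ ‖z‖ * ‖T (K - 1 + 1) (f (K - 1))‖ := by
            rw [adjoint_inner_left, show K - 1 + 1 = K by omega]
            exact abs_real_inner_le_norm _ _
          linarith
      -- the inherited slop terms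
      have hconv' : ‖adjoint (T K) z‖ * ∑ k ∈ Finset.range K, a k ≤ ‖z‖ * ∑ k ∈ Finset.range K, a k :=
        mul_le_mul_of_nonneg_right hTz hAs
      rw [hsplit, hsum, hac, if_neg (Nat.succ_ne_zero K), show K + 1 - 1 = K by omega, hasum]
      rw [show K + 1 - 1 = K by omega] at hconv
      calc |⟪adjoint (T K) z, u K - v K⟫_ℝ + ⟪z, e K⟫_ℝ + ⟪z, f K⟫_ℝ|
          ≤ |⟪adjoint (T K) z, u K - v K⟫_ℝ| + |⟪z, e K⟫_ℝ| + |⟪z, f K⟫_ℝ| := by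
            have h1 := abs_add_le (⟪adjoint (T K) z, u K - v K⟫_ℝ + ⟪z, e K⟫_ℝ) ⟪z, f K⟫_ℝ
            have h2 := abs_add_le ⟪adjoint (T K) z, u K - v K⟫_ℝ ⟪z, e K⟫_ℝ
            linarith
        _ ≤ η * Real.sqrt (S + D) * Real.sqrt (a' + c) + ‖z‖ * ∑ k ∈ Finset.range K, ‖T (k + 1) (f k)‖ + |⟪z, f K⟫_ℝ|
            + ‖z‖ * (∑ k ∈ Finset.range K, a k + a K) := by
            rw [mul_add]
            linarith

end

end Summit.AnomalousDissipation.AnomalousDissipation.Theorems.SolenoidalFractalHomogenisation.LagrangianStep
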